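import Literature.NumberTheory.Automorphic.ArchRankOneSplitCasimirRadial               -- ★ p850828 (this seat) FILE 2: `casimir_integral_prod_conj_hypBlockGL_eq` (radial equation, full-torus chart); brings ★ FILE 1 p850694, ★ p850603, ★ p850189
import Literature.NumberTheory.Automorphic.ArchRankOneCasimirLadder                    -- ★ p850639 (LH3-p04 (g4)) (ELL-∞) stage #1: `RankOneCasimir.contDiff_casimir`, `hasCompactSupport_casimir`, `iterate_casimir_mem` — CONSUMED BY NAME
import HarnessLib

/-!
# (A0-CASIMIR-∞) FILE 3: the `x`-JETS of the normalised SPLIT orbital integral of `U(J) = U(1,1)` — the Cayley bridge `Ω_D (g ∘ Ad_P) = (Ω_J g) ∘ Ad_P`, the half-chart radial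
# equation `Λ_{Ωg} = Λ_g″ − Λ_g`, and the SPLIT LADDER `Λ_f⁽²ᵏ⁾ = Λ_{(1+Ω)ᵏf}`, `Λ_f⁽²ᵏ⁺¹⁾ = (Λ_{(1+Ω)ᵏf})′` at EVERY `x` (Varadarajan 1989 §6.4 Thms 23–24; Knapp 1986 VIII §5)

Topic `NumberTheory/Automorphic`; namespace `Literature.NumberTheory.Automorphic.UnitaryGroup`.  THEOREMS ONLY (no `def`, no instance, no notation, no axiom, no named fact, no
`sorry`).  Cell `pub/hodgecm-mathlib`, crux H413 (`stmt-HodgeConjecture-24833`), line LH3 (closer stub `stub_N9`, direct road), letter L1∕L3′ pay-down brick **(A0-CASIMIR-∞)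
FILE 3** (F0P3a-p09 (g6); LH3-plan (g3) 2026-09-02T08:51:42Z «=» items (ii) «`x`-jets at the centre over ★ p850603»; FILE 1 = ★ p850694 `ArchRankOneSplitCasimirAlgebra`,
FILE 2 = ★ p850828 `ArchRankOneSplitCasimirRadial`).  DISJOINTNESS RULE honoured: LH3-p04 (g4)'s ★ `RankOneCasimir.contDiff_casimir ∕ hasCompactSupport_casimir ∕
iterate_casimir_mem` are CONSUMED BY NAME through the Cayley bridge of §1, never retyped; the elliptic `ψ`-side is ★ (ELL-∞) and not touched.

THE MATHEMATICS.  Two frames of `𝔰𝔲(1,1) ⊗ ℂ`: the DIAGONAL frame of ★ (ELL-∞) ∕ ★ Z3 (`Ω_D = −X̃₁² + X̃̂₂² + X̃̂₃²`, `X₁ = diag(i,−i)`, `X̂₂ = (0 1; 1 0)`, `X̂₃ = (0 −i; i 0)`, form `diag(2,−2)`,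
`p = q = 1`) and the SPLIT frame of ★ FILE 1 (`Ω_J = −Ỹ₁² + H̃² + Ỹ₃²`, form `J = Φ₂`).  The Cayley matrix `P = (1 1; 1 −1)` carries one to the other:
`P (X₁, X̂₂, X̂₃) P⁻¹ = (Y₁, H, Y₃)` (★ `cayleyTwo_conj_X₁∕X₂∕X₃`), hence for `g ∈ C^∞(M₂(ℂ), E)` (§1, chain rule for the linear automorphism `Ad_P` of `M₂(ℂ)`)
  **`Ω_D (g ∘ Ad_P)(Y) = (Ω_J g)(P Y P⁻¹)`**,  so `(1+Ω_D)ᵏ(f ∘ Ad_P) = ((1+Ω_J)ᵏ f) ∘ Ad_P` and `(1+Ω_J)ᵏ f ∈ C_c^∞` (from ★ `iterate_casimir_mem`).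
On the split torus, ★ FILE 2 gives `Ψ_{Ωg} = Ψ_g″ + 2Ψ_g′` for the full-torus chart integral `Ψ_g(x) = ∫_{K×N} g(k (t_x n) k⁻¹)`; the half chart of ★ p850603 ∕ ★ p850189 is
`Λ_g(x) = ∫_{K×N} g(k (t_{0,θ} h_{x∕2} n h_{x∕2}) k⁻¹) = eˣ Ψ_g(x)` (★ `integral_prod_conj_hypBlockGL_half_eq_exp_smul`), whence (§2) **`Λ_{Ωg} = Λ_g″ − Λ_g`** — Harish-Chandra's
`F_{Ωf} = (∂² − ρ²) F_f`, `ρ = 1`, at EVERY `x` (the split Cartan has no singular set).  Iterating with additivity (§3): **`Λ_f⁽²ᵏ⁾ = Λ_{(1+Ω_J)ᵏ f}`**, **`Λ_f⁽²ᵏ⁺¹⁾ = (Λ_{(1+Ω_J)ᵏ f})′`**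
everywhere, and at the centre `Λ_f⁽²ᵏ⁾(0) = ∫_{K×N} ((1+Ω_J)ᵏ f)(e^{iθ}·k n k⁻¹)` — the two-nappe CONE integral of `(1+Ω_J)ᵏ f` (★ `integral_prod_conj_hypBlockGL_half_zero`), i.e. the
split-side entry of the all-orders rank-one jump relation (the elliptic entry is ★ (ELL-∞)'s `(−1)ᵏ C₁ · cone((1+Ω_D)ᵏ (f ∘ Ad_P))`, matched through §1; junction = FILE 4).

WHAT IS PROVED.
* §1 `exists_continuousLinearEquiv_matrixConj`, `cayleyConj_mul_eq_conj_mul_conj`, `cayleyConj_mul_mul_eq`, **`fderiv_comp_matrixConj_apply`** (hypothesis-free first-order chain rule for `Ad_P`, any `P ∈ GL₂(ℂ)`),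
  **`fderiv_fderiv_comp_matrixConj_apply`** (second order, `g ∈ C^∞`), **`casimirD_comp_cayley_eq`** ∕ `casimirJ_eq_casimirD_comp_cayley` (THE BRIDGE), `contDiff_casimirJ`,
  `hasCompactSupport_casimirJ`, `iterate_casimirJ_mem`, **`iterate_casimirD_comp_cayley_eq`** (`(1+Ω_D)ᵏ(f∘Ad_P) = ((1+Ω_J)ᵏf)∘Ad_P`).
* §2 `integrable_prod_conj_hypBlockGL_half`, **`casimir_integral_prod_conj_hypBlockGL_half_eq`** (`ContDiff ℝ ∞ Λ ∧ ∀ x, Λ_Ω x = deriv (deriv Λ) x − Λ x`),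
  `integral_prod_conj_hypBlockGL_half_add`.
* §3 **`iteratedDeriv_integral_prod_conj_hypBlockGL_half`** (the ladder, family binder `Λ` with `hΛ`), **`iteratedDeriv_integral_prod_conj_hypBlockGL_half_zero`** (the jets at `x = 0`).
TECHNICAL NOTE (for the cell): after Mathlib's TVS generalisation of `fderiv`, the `TopologicalSpace M₂(ℂ)` inside `fderiv`∕`M₂(ℂ) →L[ℝ] E` is the Pi instance, while calculus lemmas
stated under `[NormedAddCommGroup]` (`fderiv_clm_apply`, `ContinuousLinearEquiv.comp_right_fderiv`, …) carry the norm-path instance: `rw`∕`simp only` with them do not match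
(defeq only by unfolding); build `HasFDerivAt` facts by term-mode composition with an ascribed statement and `rw [h.fderiv]`, or `erw`.
HONEST LABEL: HC_CM is proved only modulo the 7 printed citations (2 remaining: hLiu418 = `stmt-HodgeConjecture-24832`, h413 = `stmt-HodgeConjecture-24833`) until rung 0 closes;
count-neutral analysis toward letter L1∕L3′, pays nothing by itself.

## References
* [Varadarajan1989] V. S. Varadarajan, *An Introduction to Harmonic Analysis on Semisimple Lie Groups*, Cambridge Stud. Adv. Math. 16 (1989), §6.3; §6.4 Thm 23 (`F_{Ωf} = (∂² − ρ²)F_f`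
  on the split Cartan), Thm 24 (all orders at the centre).
* [Knapp1986] A. W. Knapp, *Representation Theory of Semisimple Groups* (1986), Ch. VIII §5 (Harish-Chandra homomorphism `Ω ↦ H² − ρ²`).
* [Shelstad1979] D. Shelstad, *Characters and inner forms of a quasi-split group over ℝ*, Compositio Math. 39 (1979), Lemma 4.3 p. 25, Prop. 4.5 p. 26.
* [Rogawski1990] J. D. Rogawski, *Automorphic Representations of Unitary Groups in Three Variables*, Ann. of Math. Stud. 123 (1990), §8.2 pp. 119–122 (the Cayley frame).
* [Hall2015] B. C. Hall, *Lie Groups, Lie Algebras, and Representations*, GTM 222 (2015), §3.6, Prop. 3.24 (`Ad` and the chain rule).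
* [Folland1995] G. B. Folland, *A Course in Abstract Harmonic Analysis* (1995), §2.6.
-/

set_option autoImplicit false

noncomputable section

open MeasureTheory Measure Set Filter Topology Complex Metric
open scoped ENNReal NNReal ComplexConjugate ContDiff Matrix.Norms.Operator MatrixGroups

namespace Literature.NumberTheory.Automorphic

open Literature.MeasureTheory.Group Literature.Analysis.FunctionSpaces

namespace UnitaryGroup

open Literature.NumberTheory.Automorphic.UnitaryGroup.HeisRing Literature.NumberTheory.Automorphic.UnitaryGroup.LineRing
open Literature.NumberTheory.Automorphic.RankOneCasimir

/-! ## §1 The Cayley bridge between the diagonal-frame Casimir `Ω_D` (★ (ELL-∞) at `p = q = 1`) and the split-frame Casimir `Ω_J` (★ FILE 1) -/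

section Bridge

variable {E : Type*} [NormedAddCommGroup E] [NormedSpace ℝ E]

/-- **Conjugation `X ↦ P X P⁻¹` by `P ∈ GL₂(ℂ)` as a continuous `ℝ`-linear automorphism of `M₂(ℂ)`** (existence with its value formula). [cite: Hall2015, §3.6] -/
theorem exists_continuousLinearEquiv_matrixConj (P : GL (Fin 2) ℂ) :
    ∃ A : Matrix (Fin 2) (Fin 2) ℂ ≃L[ℝ] Matrix (Fin 2) (Fin 2) ℂ, ∀ X, A X = (P : Matrix (Fin 2) (Fin 2) ℂ) * X * ((P⁻¹ : GL (Fin 2) ℂ) : Matrix (Fin 2) (Fin 2) ℂ) := by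
  have hPi : ((P⁻¹ : GL (Fin 2) ℂ) : Matrix (Fin 2) (Fin 2) ℂ) * (P : Matrix (Fin 2) (Fin 2) ℂ) = 1 := by
    rw [← Units.val_mul, inv_mul_cancel, Units.val_one]
  have hPi' : (P : Matrix (Fin 2) (Fin 2) ℂ) * ((P⁻¹ : GL (Fin 2) ℂ) : Matrix (Fin 2) (Fin 2) ℂ) = 1 := by
    rw [← Units.val_mul, mul_inv_cancel, Units.val_one]
  refine ⟨{ toFun := fun X => (P : Matrix (Fin 2) (Fin 2) ℂ) * X * ((P⁻¹ : GL (Fin 2) ℂ) : Matrix (Fin 2) (Fin 2) ℂ)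
            invFun := fun X => ((P⁻¹ : GL (Fin 2) ℂ) : Matrix (Fin 2) (Fin 2) ℂ) * X * (P : Matrix (Fin 2) (Fin 2) ℂ)
            map_add' := fun X Y => by rw [Matrix.mul_add, Matrix.add_mul]
            map_smul' := fun c X => by rw [Matrix.mul_smul, Matrix.smul_mul, RingHom.id_apply]
            left_inv := fun X => ?_
            right_inv := fun X => ?_
            continuous_toFun := (continuous_const.mul continuous_id).mul continuous_const
            continuous_invFun := (continuous_const.mul continuous_id).mul continuous_const }, fun X => rfl⟩
  · show ((P⁻¹ : GL (Fin 2) ℂ) : Matrix (Fin 2) (Fin 2) ℂ) * ((P : Matrix (Fin 2) (Fin 2) ℂ) * X * ((P⁻¹ : GL (Fin 2) ℂ) : Matrix (Fin 2) (Fin 2) ℂ)) * (P : Matrix (Fin 2) (Fin 2) ℂ) = X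
    calc _ = (((P⁻¹ : GL (Fin 2) ℂ) : Matrix (Fin 2) (Fin 2) ℂ) * (P : Matrix (Fin 2) (Fin 2) ℂ)) * X * (((P⁻¹ : GL (Fin 2) ℂ) : Matrix (Fin 2) (Fin 2) ℂ) * (P : Matrix (Fin 2) (Fin 2) ℂ)) := by
          simp only [Matrix.mul_assoc]
      _ = X := by rw [hPi, Matrix.one_mul, Matrix.mul_one]
  · show (P : Matrix (Fin 2) (Fin 2) ℂ) * (((P⁻¹ : GL (Fin 2) ℂ) : Matrix (Fin 2) (Fin 2) ℂ) * X * (P : Matrix (Fin 2) (Fin 2) ℂ)) * ((P⁻¹ : GL (Fin 2) ℂ) : Matrix (Fin 2) (Fin 2) ℂ) = X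
    calc _ = ((P : Matrix (Fin 2) (Fin 2) ℂ) * ((P⁻¹ : GL (Fin 2) ℂ) : Matrix (Fin 2) (Fin 2) ℂ)) * X * ((P : Matrix (Fin 2) (Fin 2) ℂ) * ((P⁻¹ : GL (Fin 2) ℂ) : Matrix (Fin 2) (Fin 2) ℂ)) := by
          simp only [Matrix.mul_assoc]
      _ = X := by rw [hPi', Matrix.one_mul, Matrix.mul_one]

/-- `P (Y X) P⁻¹ = (P Y P⁻¹)(P X P⁻¹)`. [cite: Hall2015, §3.6] -/
theorem cayleyConj_mul_eq_conj_mul_conj (P : GL (Fin 2) ℂ) (Y X : Matrix (Fin 2) (Fin 2) ℂ) :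
    (P : Matrix (Fin 2) (Fin 2) ℂ) * (Y * X) * ((P⁻¹ : GL (Fin 2) ℂ) : Matrix (Fin 2) (Fin 2) ℂ) = (P : Matrix (Fin 2) (Fin 2) ℂ) * Y * ((P⁻¹ : GL (Fin 2) ℂ) : Matrix (Fin 2) (Fin 2) ℂ) * ((P : Matrix (Fin 2) (Fin 2) ℂ) * X * ((P⁻¹ : GL (Fin 2) ℂ) : Matrix (Fin 2) (Fin 2) ℂ)) := by
  have hPi : ((P⁻¹ : GL (Fin 2) ℂ) : Matrix (Fin 2) (Fin 2) ℂ) * (P : Matrix (Fin 2) (Fin 2) ℂ) = 1 := by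
    rw [← Units.val_mul, inv_mul_cancel, Units.val_one]
  calc (P : Matrix (Fin 2) (Fin 2) ℂ) * (Y * X) * ((P⁻¹ : GL (Fin 2) ℂ) : Matrix (Fin 2) (Fin 2) ℂ)
      = (P : Matrix (Fin 2) (Fin 2) ℂ) * Y * (((P⁻¹ : GL (Fin 2) ℂ) : Matrix (Fin 2) (Fin 2) ℂ) * (P : Matrix (Fin 2) (Fin 2) ℂ)) * X * ((P⁻¹ : GL (Fin 2) ℂ) : Matrix (Fin 2) (Fin 2) ℂ) := by
        rw [hPi, Matrix.mul_one]; simp only [Matrix.mul_assoc]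
    _ = _ := by simp only [Matrix.mul_assoc]

/-- `P (Y X X) P⁻¹ = (P Y P⁻¹)(P X P⁻¹)(P X P⁻¹)`. [cite: Hall2015, §3.6] -/
theorem cayleyConj_mul_mul_eq (P : GL (Fin 2) ℂ) (Y X : Matrix (Fin 2) (Fin 2) ℂ) :
    (P : Matrix (Fin 2) (Fin 2) ℂ) * (Y * X * X) * ((P⁻¹ : GL (Fin 2) ℂ) : Matrix (Fin 2) (Fin 2) ℂ) =
      (P : Matrix (Fin 2) (Fin 2) ℂ) * Y * ((P⁻¹ : GL (Fin 2) ℂ) : Matrix (Fin 2) (Fin 2) ℂ) * ((P : Matrix (Fin 2) (Fin 2) ℂ) * X * ((P⁻¹ : GL (Fin 2) ℂ) : Matrix (Fin 2) (Fin 2) ℂ)) * ((P : Matrix (Fin 2) (Fin 2) ℂ) * X * ((P⁻¹ : GL (Fin 2) ℂ) : Matrix (Fin 2) (Fin 2) ℂ)) := by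
  rw [cayleyConj_mul_eq_conj_mul_conj P (Y * X) X, cayleyConj_mul_eq_conj_mul_conj P Y X]

/-- **Chain rule for conjugation, first order, hypothesis-free**: `D(g ∘ Ad_P)(Y)[V] = Dg(P Y P⁻¹)[P V P⁻¹]` for EVERY `g : M₂(ℂ) → E` (both sides vanish where `g` is not
differentiable: Mathlib `ContinuousLinearEquiv.comp_right_fderiv`). [cite: Hall2015, §3.6, Prop. 3.24] -/
theorem fderiv_comp_matrixConj_apply (P : GL (Fin 2) ℂ) (g : Matrix (Fin 2) (Fin 2) ℂ → E) (Y V : Matrix (Fin 2) (Fin 2) ℂ) :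
    fderiv ℝ (fun X => g ((P : Matrix (Fin 2) (Fin 2) ℂ) * X * ((P⁻¹ : GL (Fin 2) ℂ) : Matrix (Fin 2) (Fin 2) ℂ))) Y V =
      fderiv ℝ g ((P : Matrix (Fin 2) (Fin 2) ℂ) * Y * ((P⁻¹ : GL (Fin 2) ℂ) : Matrix (Fin 2) (Fin 2) ℂ)) ((P : Matrix (Fin 2) (Fin 2) ℂ) * V * ((P⁻¹ : GL (Fin 2) ℂ) : Matrix (Fin 2) (Fin 2) ℂ)) := by
  obtain ⟨A, hA⟩ := exists_continuousLinearEquiv_matrixConj P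
  have hcomp : (fun X => g ((P : Matrix (Fin 2) (Fin 2) ℂ) * X * ((P⁻¹ : GL (Fin 2) ℂ) : Matrix (Fin 2) (Fin 2) ℂ))) = g ∘ A :=
    funext fun X => by rw [Function.comp_apply, hA]
  rw [hcomp]
  erw [A.comp_right_fderiv]
  show fderiv ℝ g (A Y) (A V) = _
  rw [hA, hA]

/-- **Chain rule for conjugation, second order**: `D²(g ∘ Ad_P)(Y)[U, V] = D²g(P Y P⁻¹)[P U P⁻¹, P V P⁻¹]` for `g ∈ C^∞` (the first-order identity twice and Mathlib
`fderiv_clm_apply`; no operator-valued chain rule is needed). [cite: Hall2015, §3.6, Prop. 3.24] -/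
theorem fderiv_fderiv_comp_matrixConj_apply (P : GL (Fin 2) ℂ) {g : Matrix (Fin 2) (Fin 2) ℂ → E} (hg : ContDiff ℝ ∞ g) (Y U V : Matrix (Fin 2) (Fin 2) ℂ) :
    fderiv ℝ (fderiv ℝ (fun X => g ((P : Matrix (Fin 2) (Fin 2) ℂ) * X * ((P⁻¹ : GL (Fin 2) ℂ) : Matrix (Fin 2) (Fin 2) ℂ)))) Y U V =
      fderiv ℝ (fderiv ℝ g) ((P : Matrix (Fin 2) (Fin 2) ℂ) * Y * ((P⁻¹ : GL (Fin 2) ℂ) : Matrix (Fin 2) (Fin 2) ℂ))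
        ((P : Matrix (Fin 2) (Fin 2) ℂ) * U * ((P⁻¹ : GL (Fin 2) ℂ) : Matrix (Fin 2) (Fin 2) ℂ)) ((P : Matrix (Fin 2) (Fin 2) ℂ) * V * ((P⁻¹ : GL (Fin 2) ℂ) : Matrix (Fin 2) (Fin 2) ℂ)) := by
  have ha : ContDiff ℝ ∞ fun X : Matrix (Fin 2) (Fin 2) ℂ => (P : Matrix (Fin 2) (Fin 2) ℂ) * X * ((P⁻¹ : GL (Fin 2) ℂ) : Matrix (Fin 2) (Fin 2) ℂ) := (contDiff_const.mul contDiff_id).mul contDiff_const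
  have hga : ContDiff ℝ ∞ fun X => g ((P : Matrix (Fin 2) (Fin 2) ℂ) * X * ((P⁻¹ : GL (Fin 2) ℂ) : Matrix (Fin 2) (Fin 2) ℂ)) := hg.comp ha
  have hD1 := (contDiff_infty_iff_fderiv.1 (contDiff_infty_iff_fderiv.1 hga).2).1
  have hDg := (contDiff_infty_iff_fderiv.1 (contDiff_infty_iff_fderiv.1 hg).2).1
  -- (1) un-apply the outer `V` (`X ↦ c(X)[V] = (apply V) ∘ c`)
  have e1 : fderiv ℝ (fderiv ℝ (fun X => g ((P : Matrix (Fin 2) (Fin 2) ℂ) * X * ((P⁻¹ : GL (Fin 2) ℂ) : Matrix (Fin 2) (Fin 2) ℂ)))) Y U V =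
      fderiv ℝ (fun X => fderiv ℝ (fun X => g ((P : Matrix (Fin 2) (Fin 2) ℂ) * X * ((P⁻¹ : GL (Fin 2) ℂ) : Matrix (Fin 2) (Fin 2) ℂ))) X V) Y U := by
    have h1 : HasFDerivAt (fun X => fderiv ℝ (fun X => g ((P : Matrix (Fin 2) (Fin 2) ℂ) * X * ((P⁻¹ : GL (Fin 2) ℂ) : Matrix (Fin 2) (Fin 2) ℂ))) X V)
        ((ContinuousLinearMap.apply ℝ E V).comp (fderiv ℝ (fderiv ℝ (fun X => g ((P : Matrix (Fin 2) (Fin 2) ℂ) * X * ((P⁻¹ : GL (Fin 2) ℂ) : Matrix (Fin 2) (Fin 2) ℂ)))) Y)) Y :=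
      (ContinuousLinearMap.apply ℝ E V).hasFDerivAt.comp Y (hD1 Y).hasFDerivAt
    rw [h1.fderiv]
    rfl
  -- (2) first order inside, as functions
  have e2 : (fun X => fderiv ℝ (fun X => g ((P : Matrix (Fin 2) (Fin 2) ℂ) * X * ((P⁻¹ : GL (Fin 2) ℂ) : Matrix (Fin 2) (Fin 2) ℂ))) X V) =
      fun X => fderiv ℝ g ((P : Matrix (Fin 2) (Fin 2) ℂ) * X * ((P⁻¹ : GL (Fin 2) ℂ) : Matrix (Fin 2) (Fin 2) ℂ)) ((P : Matrix (Fin 2) (Fin 2) ℂ) * V * ((P⁻¹ : GL (Fin 2) ℂ) : Matrix (Fin 2) (Fin 2) ℂ)) :=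
    funext fun X => fderiv_comp_matrixConj_apply P g X V
  -- (3) first order again, for `Z ↦ Dg(Z)[P V P⁻¹]`
  have e3 := fderiv_comp_matrixConj_apply P (fun Z => fderiv ℝ g Z ((P : Matrix (Fin 2) (Fin 2) ℂ) * V * ((P⁻¹ : GL (Fin 2) ℂ) : Matrix (Fin 2) (Fin 2) ℂ))) Y U
  -- (4) re-apply (`Z ↦ Dg(Z)[PVP⁻¹] = (apply (PVP⁻¹)) ∘ Dg`)
  have e4 : fderiv ℝ (fun Z => fderiv ℝ g Z ((P : Matrix (Fin 2) (Fin 2) ℂ) * V * ((P⁻¹ : GL (Fin 2) ℂ) : Matrix (Fin 2) (Fin 2) ℂ))) ((P : Matrix (Fin 2) (Fin 2) ℂ) * Y * ((P⁻¹ : GL (Fin 2) ℂ) : Matrix (Fin 2) (Fin 2) ℂ)) ((P : Matrix (Fin 2) (Fin 2) ℂ) * U * ((P⁻¹ : GL (Fin 2) ℂ) : Matrix (Fin 2) (Fin 2) ℂ)) = fderiv ℝ (fderiv ℝ g) ((P : Matrix (Fin 2) (Fin 2) ℂ) * Y * ((P⁻¹ : GL (Fin 2) ℂ) : Matrix (Fin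 2) (Fin 2) ℂ)) ((P : Matrix (Fin 2) (Fin 2) ℂ) * U * ((P⁻¹ : GL (Fin 2) ℂ) : Matrix (Fin 2) (Fin 2) ℂ)) ((P : Matrix (Fin 2) (Fin 2) ℂ) * V * ((P⁻¹ : GL (Fin 2) ℂ) : Matrix (Fin 2) (Fin 2) ℂ)) := by
    have h4 : HasFDerivAt (fun Z => fderiv ℝ g Z ((P : Matrix (Fin 2) (Fin 2) ℂ) * V * ((P⁻¹ : GL (Fin 2) ℂ) : Matrix (Fin 2) (Fin 2) ℂ))) ((ContinuousLinearMap.apply ℝ E ((P : Matrix (Fin 2) (Fin 2) ℂ) * V * ((P⁻¹ : GL (Fin 2) ℂ) : Matrix (Fin 2) (Fin 2) ℂ))).comp (fderiv ℝ (fderiv ℝ g) ((P : Matrix (Fin 2) (Fin 2) ℂ) * Y * ((P⁻¹ : GL (Fin 2) ℂ) : Matrix (Fin 2) (Fin 2) ℂ)))) ((P : Matrix (Fin 2) (Fin 2) ℂ) * Y * ((P⁻¹ : GL (Fin 2) ℂ) : Matrix (Fin 2) (Fin 2) ℂ)) :=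
      (ContinuousLinearMap.apply ℝ E ((P : Matrix (Fin 2) (Fin 2) ℂ) * V * ((P⁻¹ : GL (Fin 2) ℂ) : Matrix (Fin 2) (Fin 2) ℂ))).hasFDerivAt.comp ((P : Matrix (Fin 2) (Fin 2) ℂ) * Y * ((P⁻¹ : GL (Fin 2) ℂ) : Matrix (Fin 2) (Fin 2) ℂ)) (hDg _).hasFDerivAt
    rw [h4.fderiv]
    rfl
  rw [e1, e2, e3, e4]

/-- **THE CAYLEY BRIDGE `Ω_D ∘ Ad_P^* = Ad_P^* ∘ Ω_J`.**  `Ω_D` = the `½tr`-Casimir in the DIAGONAL frame of ★ (ELL-∞) (`X₁ = diag(i,−i)`, `X̂₂ = (0 1; 1 0)`, `X̂₃ = (0 −i; i 0)`,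
i.e. ★ `RankOneCasimir.contDiff_casimir`'s hypothesis at `p = q = 1`), `Ω_J` = the split-frame Casimir of ★ FILE 1 (`Y₁ = (0 i; i 0)`, `H = diag(1,−1)`, `Y₃ = (0 i; −i 0)`), both bound
operators with their defining hypotheses; `P = (1 1; 1 −1)`.  For `g ∈ C^∞(M₂(ℂ), E)` and every `Y`: **`Ω_D (g ∘ Ad_P) (Y) = (Ω_J g)(P Y P⁻¹)`** — the chain rules above and the transport
`P (X₁, X̂₂, X̂₃) P⁻¹ = (Y₁, H, Y₃)` (★ `cayleyTwo_conj_X₁∕X₂∕X₃`). [cite: Hall2015, §3.6, Prop. 3.24] [cite: Rogawski1990, §8.2 p. 122] [cite: Varadarajan1989, §6.3] -/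
theorem casimirD_comp_cayley_eq (ΩD ΩJ : (Matrix (Fin 2) (Fin 2) ℂ → E) → Matrix (Fin 2) (Fin 2) ℂ → E)
    (hΩD : ∀ (g : Matrix (Fin 2) (Fin 2) ℂ → E) (Y : Matrix (Fin 2) (Fin 2) ℂ), ΩD g Y =
      -(fderiv ℝ (fderiv ℝ g) Y (Y * !![I, 0; 0, -I]) (Y * !![I, 0; 0, -I]) + fderiv ℝ g Y (Y * !![I, 0; 0, -I] * !![I, 0; 0, -I])) +
        (fderiv ℝ (fderiv ℝ g) Y (Y * !![(0 : ℂ), ((1 : ℝ) : ℂ); ((1 : ℝ) : ℂ), 0]) (Y * !![(0 : ℂ), ((1 : ℝ) : ℂ); ((1 : ℝ) : ℂ), 0]) +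
          fderiv ℝ g Y (Y * !![(0 : ℂ), ((1 : ℝ) : ℂ); ((1 : ℝ) : ℂ), 0] * !![(0 : ℂ), ((1 : ℝ) : ℂ); ((1 : ℝ) : ℂ), 0])) +
        (fderiv ℝ (fderiv ℝ g) Y (Y * !![(0 : ℂ), -(((1 : ℝ) : ℂ) * I); ((1 : ℝ) : ℂ) * I, 0]) (Y * !![(0 : ℂ), -(((1 : ℝ) : ℂ) * I); ((1 : ℝ) : ℂ) * I, 0]) +
          fderiv ℝ g Y (Y * !![(0 : ℂ), -(((1 : ℝ) : ℂ) * I); ((1 : ℝ) : ℂ) * I, 0] * !![(0 : ℂ), -(((1 : ℝ) : ℂ) * I); ((1 : ℝ) : ℂ) * I, 0])))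
    (hΩJ : ∀ (g : Matrix (Fin 2) (Fin 2) ℂ → E) (Y : Matrix (Fin 2) (Fin 2) ℂ), ΩJ g Y =
      -(fderiv ℝ (fderiv ℝ g) Y (Y * !![0, I; I, 0]) (Y * !![0, I; I, 0]) + fderiv ℝ g Y (Y * !![0, I; I, 0] * !![0, I; I, 0])) +
        (fderiv ℝ (fderiv ℝ g) Y (Y * !![1, 0; 0, -1]) (Y * !![1, 0; 0, -1]) + fderiv ℝ g Y (Y * !![1, 0; 0, -1] * !![1, 0; 0, -1])) +
        (fderiv ℝ (fderiv ℝ g) Y (Y * !![0, I; -I, 0]) (Y * !![0, I; -I, 0]) + fderiv ℝ g Y (Y * !![0, I; -I, 0] * !![0, I; -I, 0])))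
    {g : Matrix (Fin 2) (Fin 2) ℂ → E} (hg : ContDiff ℝ ∞ g) (Y : Matrix (Fin 2) (Fin 2) ℂ) :
    ΩD (fun X => g (((Matrix.GeneralLinearGroup.mkOfDetNeZero !![(1 : ℂ), 1; 1, -1] det_cayleyTwo_ne_zero : GL (Fin 2) ℂ) : Matrix (Fin 2) (Fin 2) ℂ) * X * (((Matrix.GeneralLinearGroup.mkOfDetNeZero !![(1 : ℂ), 1; 1, -1] det_cayleyTwo_ne_zero)⁻¹ : GL (Fin 2) ℂ) : Matrix (Fin 2) (Fin 2) ℂ))) Y = ΩJ g (((Matrix.GeneralLinearGroup.mkOfDetNeZero !![(1 : ℂ), 1; 1, -1] det_cayleyTwo_ne_zero : GL (Fin 2) ℂ) : Matrix (Fin 2) (Fin 2) ℂ) * Y * (((Matrix.GeneralLinearGroup.mkOfDetNeZero !![(1 : ℂ), 1; 1, -1] det_cayleyTwo_ne_zero)⁻¹ : GL (Fin 2) ℂ) : Matrix (Fin 2) (Fin 2) ℂ)) := by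
  rw [hΩD, hΩJ]
  simp only [fderiv_comp_matrixConj_apply, fderiv_fderiv_comp_matrixConj_apply _ hg, cayleyConj_mul_mul_eq, cayleyConj_mul_eq_conj_mul_conj _ Y,
    cayleyTwo_conj_X₁, cayleyTwo_conj_X₂, cayleyTwo_conj_X₃]

/-- **The bridge read backwards**: `(Ω_J g)(Y) = Ω_D (g ∘ Ad_P) (P⁻¹ Y P)` for `g ∈ C^∞`. [cite: Hall2015, §3.6] -/
theorem casimirJ_eq_casimirD_comp_cayley (ΩD ΩJ : (Matrix (Fin 2) (Fin 2) ℂ → E) → Matrix (Fin 2) (Fin 2) ℂ → E)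
    (hΩD : ∀ (g : Matrix (Fin 2) (Fin 2) ℂ → E) (Y : Matrix (Fin 2) (Fin 2) ℂ), ΩD g Y =
      -(fderiv ℝ (fderiv ℝ g) Y (Y * !![I, 0; 0, -I]) (Y * !![I, 0; 0, -I]) + fderiv ℝ g Y (Y * !![I, 0; 0, -I] * !![I, 0; 0, -I])) +
        (fderiv ℝ (fderiv ℝ g) Y (Y * !![(0 : ℂ), ((1 : ℝ) : ℂ); ((1 : ℝ) : ℂ), 0]) (Y * !![(0 : ℂ), ((1 : ℝ) : ℂ); ((1 : ℝ) : ℂ), 0]) +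
          fderiv ℝ g Y (Y * !![(0 : ℂ), ((1 : ℝ) : ℂ); ((1 : ℝ) : ℂ), 0] * !![(0 : ℂ), ((1 : ℝ) : ℂ); ((1 : ℝ) : ℂ), 0])) +
        (fderiv ℝ (fderiv ℝ g) Y (Y * !![(0 : ℂ), -(((1 : ℝ) : ℂ) * I); ((1 : ℝ) : ℂ) * I, 0]) (Y * !![(0 : ℂ), -(((1 : ℝ) : ℂ) * I); ((1 : ℝ) : ℂ) * I, 0]) +
          fderiv ℝ g Y (Y * !![(0 : ℂ), -(((1 : ℝ) : ℂ) * I); ((1 : ℝ) : ℂ) * I, 0] * !![(0 : ℂ), -(((1 : ℝ) : ℂ) * I); ((1 : ℝ) : ℂ) * I, 0])))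
    (hΩJ : ∀ (g : Matrix (Fin 2) (Fin 2) ℂ → E) (Y : Matrix (Fin 2) (Fin 2) ℂ), ΩJ g Y =
      -(fderiv ℝ (fderiv ℝ g) Y (Y * !![0, I; I, 0]) (Y * !![0, I; I, 0]) + fderiv ℝ g Y (Y * !![0, I; I, 0] * !![0, I; I, 0])) +
        (fderiv ℝ (fderiv ℝ g) Y (Y * !![1, 0; 0, -1]) (Y * !![1, 0; 0, -1]) + fderiv ℝ g Y (Y * !![1, 0; 0, -1] * !![1, 0; 0, -1])) +
        (fderiv ℝ (fderiv ℝ g) Y (Y * !![0, I; -I, 0]) (Y * !![0, I; -I, 0]) + fderiv ℝ g Y (Y * !![0, I; -I, 0] * !![0, I; -I, 0])))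
    {g : Matrix (Fin 2) (Fin 2) ℂ → E} (hg : ContDiff ℝ ∞ g) (Y : Matrix (Fin 2) (Fin 2) ℂ) :
    ΩJ g Y = ΩD (fun X => g (((Matrix.GeneralLinearGroup.mkOfDetNeZero !![(1 : ℂ), 1; 1, -1] det_cayleyTwo_ne_zero : GL (Fin 2) ℂ) : Matrix (Fin 2) (Fin 2) ℂ) * X * (((Matrix.GeneralLinearGroup.mkOfDetNeZero !![(1 : ℂ), 1; 1, -1] det_cayleyTwo_ne_zero)⁻¹ : GL (Fin 2) ℂ) : Matrix (Fin 2) (Fin 2) ℂ))) ((((Matrix.GeneralLinearGroup.mkOfDetNeZero !![(1 : ℂ), 1; 1, -1] det_cayleyTwo_ne_zero)⁻¹ : GL (Fin 2) ℂ) : Matrix (Fin 2) (Fin 2) ℂ) * Y * ((Matrix.GeneralLinearGroup.mkOfDetNeZero !![(1 : ℂ), 1; 1, -1] det_cayleyTwo_ne_zero : GL (Fin 2) ℂ) : Matrix (Fin 2) (Fin 2) ℂ)) := by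
  rw [casimirD_comp_cayley_eq ΩD ΩJ hΩD hΩJ hg]
  congr 1
  have hPi' : ((Matrix.GeneralLinearGroup.mkOfDetNeZero !![(1 : ℂ), 1; 1, -1] det_cayleyTwo_ne_zero : GL (Fin 2) ℂ) : Matrix (Fin 2) (Fin 2) ℂ) * (((Matrix.GeneralLinearGroup.mkOfDetNeZero !![(1 : ℂ), 1; 1, -1] det_cayleyTwo_ne_zero)⁻¹ : GL (Fin 2) ℂ) : Matrix (Fin 2) (Fin 2) ℂ) = 1 := by
    rw [← Units.val_mul, mul_inv_cancel, Units.val_one]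
  calc Y = (((Matrix.GeneralLinearGroup.mkOfDetNeZero !![(1 : ℂ), 1; 1, -1] det_cayleyTwo_ne_zero : GL (Fin 2) ℂ) : Matrix (Fin 2) (Fin 2) ℂ) * (((Matrix.GeneralLinearGroup.mkOfDetNeZero !![(1 : ℂ), 1; 1, -1] det_cayleyTwo_ne_zero)⁻¹ : GL (Fin 2) ℂ) : Matrix (Fin 2) (Fin 2) ℂ)) * Y * (((Matrix.GeneralLinearGroup.mkOfDetNeZero !![(1 : ℂ), 1; 1, -1] det_cayleyTwo_ne_zero : GL (Fin 2) ℂ) : Matrix (Fin 2) (Fin 2) ℂ) * (((Matrix.GeneralLinearGroup.mkOfDetNeZero !![(1 : ℂ), 1; 1, -1] det_cayleyTwo_ne_zero)⁻¹ : GL (Fin 2) ℂ) : Matrix (Fin 2) (Fin 2) ℂ)) := by rw [hPi', Matrix.one_mul, Matrix.mul_one]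
    _ = _ := by simp only [Matrix.mul_assoc]

/-- **`g ∈ C^∞ ⇒ Ω_J g ∈ C^∞`** — ★ `RankOneCasimir.contDiff_casimir` (LH3-p04 (g4)) CONSUMED BY NAME through the bridge: `Ω_J g = (Ω_D (g ∘ Ad_P)) ∘ Ad_{P⁻¹}`.
[cite: Varadarajan1989, §6.3] [cite: Hall2015, §3.6] -/
theorem contDiff_casimirJ (ΩJ : (Matrix (Fin 2) (Fin 2) ℂ → E) → Matrix (Fin 2) (Fin 2) ℂ → E)
    (hΩJ : ∀ (g : Matrix (Fin 2) (Fin 2) ℂ → E) (Y : Matrix (Fin 2) (Fin 2) ℂ), ΩJ g Y =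
      -(fderiv ℝ (fderiv ℝ g) Y (Y * !![0, I; I, 0]) (Y * !![0, I; I, 0]) + fderiv ℝ g Y (Y * !![0, I; I, 0] * !![0, I; I, 0])) +
        (fderiv ℝ (fderiv ℝ g) Y (Y * !![1, 0; 0, -1]) (Y * !![1, 0; 0, -1]) + fderiv ℝ g Y (Y * !![1, 0; 0, -1] * !![1, 0; 0, -1])) +
        (fderiv ℝ (fderiv ℝ g) Y (Y * !![0, I; -I, 0]) (Y * !![0, I; -I, 0]) + fderiv ℝ g Y (Y * !![0, I; -I, 0] * !![0, I; -I, 0])))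
    {g : Matrix (Fin 2) (Fin 2) ℂ → E} (hg : ContDiff ℝ ∞ g) : ContDiff ℝ ∞ (ΩJ g) := by
  obtain ⟨ΩD, hΩD⟩ : ∃ ΩD : (Matrix (Fin 2) (Fin 2) ℂ → E) → Matrix (Fin 2) (Fin 2) ℂ → E, ∀ (g : Matrix (Fin 2) (Fin 2) ℂ → E) (Y : Matrix (Fin 2) (Fin 2) ℂ), ΩD g Y =
      -(fderiv ℝ (fderiv ℝ g) Y (Y * !![I, 0; 0, -I]) (Y * !![I, 0; 0, -I]) + fderiv ℝ g Y (Y * !![I, 0; 0, -I] * !![I, 0; 0, -I])) +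
        (fderiv ℝ (fderiv ℝ g) Y (Y * !![(0 : ℂ), ((1 : ℝ) : ℂ); ((1 : ℝ) : ℂ), 0]) (Y * !![(0 : ℂ), ((1 : ℝ) : ℂ); ((1 : ℝ) : ℂ), 0]) +
          fderiv ℝ g Y (Y * !![(0 : ℂ), ((1 : ℝ) : ℂ); ((1 : ℝ) : ℂ), 0] * !![(0 : ℂ), ((1 : ℝ) : ℂ); ((1 : ℝ) : ℂ), 0])) +
        (fderiv ℝ (fderiv ℝ g) Y (Y * !![(0 : ℂ), -(((1 : ℝ) : ℂ) * I); ((1 : ℝ) : ℂ) * I, 0]) (Y * !![(0 : ℂ), -(((1 : ℝ) : ℂ) * I); ((1 : ℝ) : ℂ) * I, 0]) +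
          fderiv ℝ g Y (Y * !![(0 : ℂ), -(((1 : ℝ) : ℂ) * I); ((1 : ℝ) : ℂ) * I, 0] * !![(0 : ℂ), -(((1 : ℝ) : ℂ) * I); ((1 : ℝ) : ℂ) * I, 0])) := ⟨fun g Y => _, fun g Y => rfl⟩
  have ha : ContDiff ℝ ∞ fun X : Matrix (Fin 2) (Fin 2) ℂ => ((Matrix.GeneralLinearGroup.mkOfDetNeZero !![(1 : ℂ), 1; 1, -1] det_cayleyTwo_ne_zero : GL (Fin 2) ℂ) : Matrix (Fin 2) (Fin 2) ℂ) * X * (((Matrix.GeneralLinearGroup.mkOfDetNeZero !![(1 : ℂ), 1; 1, -1] det_cayleyTwo_ne_zero)⁻¹ : GL (Fin 2) ℂ) : Matrix (Fin 2) (Fin 2) ℂ) := (contDiff_const.mul contDiff_id).mul contDiff_const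
  have ha' : ContDiff ℝ ∞ fun X : Matrix (Fin 2) (Fin 2) ℂ => (((Matrix.GeneralLinearGroup.mkOfDetNeZero !![(1 : ℂ), 1; 1, -1] det_cayleyTwo_ne_zero)⁻¹ : GL (Fin 2) ℂ) : Matrix (Fin 2) (Fin 2) ℂ) * X * ((Matrix.GeneralLinearGroup.mkOfDetNeZero !![(1 : ℂ), 1; 1, -1] det_cayleyTwo_ne_zero : GL (Fin 2) ℂ) : Matrix (Fin 2) (Fin 2) ℂ) := (contDiff_const.mul contDiff_id).mul contDiff_const
  have he : ΩJ g = fun Y => ΩD (fun X => g (((Matrix.GeneralLinearGroup.mkOfDetNeZero !![(1 : ℂ), 1; 1, -1] det_cayleyTwo_ne_zero : GL (Fin 2) ℂ) : Matrix (Fin 2) (Fin 2) ℂ) * X * (((Matrix.GeneralLinearGroup.mkOfDetNeZero !![(1 : ℂ), 1; 1, -1] det_cayleyTwo_ne_zero)⁻¹ : GL (Fin 2) ℂ) : Matrix (Fin 2) (Fin 2) ℂ))) ((((Matrix.GeneralLinearGroup.mkOfDetNeZero !![(1 : ℂ), 1; 1, -1] det_cayleyTwo_ne_zero)⁻¹ :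 GL (Fin 2) ℂ) : Matrix (Fin 2) (Fin 2) ℂ) * Y * ((Matrix.GeneralLinearGroup.mkOfDetNeZero !![(1 : ℂ), 1; 1, -1] det_cayleyTwo_ne_zero : GL (Fin 2) ℂ) : Matrix (Fin 2) (Fin 2) ℂ)) :=
    funext fun Y => casimirJ_eq_casimirD_comp_cayley ΩD ΩJ hΩD hΩJ hg Y
  rw [he]
  exact (contDiff_casimir 1 1 ΩD hΩD (hg.comp ha)).comp ha'

/-- **`g ∈ C_c^∞ ⇒ Ω_J g` compactly supported** — ★ `RankOneCasimir.hasCompactSupport_casimir` CONSUMED BY NAME through the bridge (`Ad_P` is a homeomorphism of `M₂(ℂ)`).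
[cite: Varadarajan1989, §6.3] [cite: Hall2015, §3.6] -/
theorem hasCompactSupport_casimirJ (ΩJ : (Matrix (Fin 2) (Fin 2) ℂ → E) → Matrix (Fin 2) (Fin 2) ℂ → E)
    (hΩJ : ∀ (g : Matrix (Fin 2) (Fin 2) ℂ → E) (Y : Matrix (Fin 2) (Fin 2) ℂ), ΩJ g Y =
      -(fderiv ℝ (fderiv ℝ g) Y (Y * !![0, I; I, 0]) (Y * !![0, I; I, 0]) + fderiv ℝ g Y (Y * !![0, I; I, 0] * !![0, I; I, 0])) +
        (fderiv ℝ (fderiv ℝ g) Y (Y * !![1, 0; 0, -1]) (Y * !![1, 0; 0, -1]) + fderiv ℝ g Y (Y * !![1, 0; 0, -1] * !![1, 0; 0, -1])) +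
        (fderiv ℝ (fderiv ℝ g) Y (Y * !![0, I; -I, 0]) (Y * !![0, I; -I, 0]) + fderiv ℝ g Y (Y * !![0, I; -I, 0] * !![0, I; -I, 0])))
    {g : Matrix (Fin 2) (Fin 2) ℂ → E} (hg : ContDiff ℝ ∞ g) (hgc : HasCompactSupport g) : HasCompactSupport (ΩJ g) := by
  obtain ⟨ΩD, hΩD⟩ : ∃ ΩD : (Matrix (Fin 2) (Fin 2) ℂ → E) → Matrix (Fin 2) (Fin 2) ℂ → E, ∀ (g : Matrix (Fin 2) (Fin 2) ℂ → E) (Y : Matrix (Fin 2) (Fin 2) ℂ), ΩD g Y =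
      -(fderiv ℝ (fderiv ℝ g) Y (Y * !![I, 0; 0, -I]) (Y * !![I, 0; 0, -I]) + fderiv ℝ g Y (Y * !![I, 0; 0, -I] * !![I, 0; 0, -I])) +
        (fderiv ℝ (fderiv ℝ g) Y (Y * !![(0 : ℂ), ((1 : ℝ) : ℂ); ((1 : ℝ) : ℂ), 0]) (Y * !![(0 : ℂ), ((1 : ℝ) : ℂ); ((1 : ℝ) : ℂ), 0]) +
          fderiv ℝ g Y (Y * !![(0 : ℂ), ((1 : ℝ) : ℂ); ((1 : ℝ) : ℂ), 0] * !![(0 : ℂ), ((1 : ℝ) : ℂ); ((1 : ℝ) : ℂ), 0])) +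
        (fderiv ℝ (fderiv ℝ g) Y (Y * !![(0 : ℂ), -(((1 : ℝ) : ℂ) * I); ((1 : ℝ) : ℂ) * I, 0]) (Y * !![(0 : ℂ), -(((1 : ℝ) : ℂ) * I); ((1 : ℝ) : ℂ) * I, 0]) +
          fderiv ℝ g Y (Y * !![(0 : ℂ), -(((1 : ℝ) : ℂ) * I); ((1 : ℝ) : ℂ) * I, 0] * !![(0 : ℂ), -(((1 : ℝ) : ℂ) * I); ((1 : ℝ) : ℂ) * I, 0])) := ⟨fun g Y => _, fun g Y => rfl⟩
  obtain ⟨A, hA⟩ := exists_continuousLinearEquiv_matrixConj (Matrix.GeneralLinearGroup.mkOfDetNeZero !![(1 : ℂ), 1; 1, -1] det_cayleyTwo_ne_zero)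
  have hPi' : ((Matrix.GeneralLinearGroup.mkOfDetNeZero !![(1 : ℂ), 1; 1, -1] det_cayleyTwo_ne_zero : GL (Fin 2) ℂ) : Matrix (Fin 2) (Fin 2) ℂ) * (((Matrix.GeneralLinearGroup.mkOfDetNeZero !![(1 : ℂ), 1; 1, -1] det_cayleyTwo_ne_zero)⁻¹ : GL (Fin 2) ℂ) : Matrix (Fin 2) (Fin 2) ℂ) = 1 := by
    rw [← Units.val_mul, mul_inv_cancel, Units.val_one]
  have hback : ∀ X : Matrix (Fin 2) (Fin 2) ℂ, ((Matrix.GeneralLinearGroup.mkOfDetNeZero !![(1 : ℂ), 1; 1, -1] det_cayleyTwo_ne_zero : GL (Fin 2) ℂ) : Matrix (Fin 2) (Fin 2) ℂ) * ((((Matrix.GeneralLinearGroup.mkOfDetNeZero !![(1 : ℂ), 1; 1, -1] det_cayleyTwo_ne_zero)⁻¹ : GL (Fin 2) ℂ) : Matrix (Fin 2) (Fin 2) ℂ) * X * ((Matrix.GeneralLinearGroup.mkOfDetNeZero !![(1 : ℂ), 1; 1, -1] det_cayleyTwo_ne_zero : GL (Fin 2) ℂ) : Matrix (Fin 2) (Fin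 2) ℂ)) * (((Matrix.GeneralLinearGroup.mkOfDetNeZero !![(1 : ℂ), 1; 1, -1] det_cayleyTwo_ne_zero)⁻¹ : GL (Fin 2) ℂ) : Matrix (Fin 2) (Fin 2) ℂ) = X := fun X => by
    calc _ = (((Matrix.GeneralLinearGroup.mkOfDetNeZero !![(1 : ℂ), 1; 1, -1] det_cayleyTwo_ne_zero : GL (Fin 2) ℂ) : Matrix (Fin 2) (Fin 2) ℂ) * (((Matrix.GeneralLinearGroup.mkOfDetNeZero !![(1 : ℂ), 1; 1, -1] det_cayleyTwo_ne_zero)⁻¹ : GL (Fin 2) ℂ) : Matrix (Fin 2) (Fin 2) ℂ)) * X * (((Matrix.GeneralLinearGroup.mkOfDetNeZero !![(1 : ℂ), 1; 1, -1] det_cayleyTwo_ne_zero : GL (Fin 2) ℂ) : Matrix (Fin 2) (Fin 2) ℂ) * (((Matrix.GeneralLinearGroup.mkOfDetNeZero !![(1 : ℂ), 1; 1, -1] det_cayleyTwo_ne_zero)⁻¹ : GL (Fin 2) ℂ) : Matrix (Fin 2) (Fin 2) ℂ)) := by simp only [Matrix.mul_assoc]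
      _ = X := by rw [hPi', Matrix.one_mul, Matrix.mul_one]
  have hAsymm : ∀ X, A.symm X = (((Matrix.GeneralLinearGroup.mkOfDetNeZero !![(1 : ℂ), 1; 1, -1] det_cayleyTwo_ne_zero)⁻¹ : GL (Fin 2) ℂ) : Matrix (Fin 2) (Fin 2) ℂ) * X * ((Matrix.GeneralLinearGroup.mkOfDetNeZero !![(1 : ℂ), 1; 1, -1] det_cayleyTwo_ne_zero : GL (Fin 2) ℂ) : Matrix (Fin 2) (Fin 2) ℂ) := fun X => by
    apply A.injective
    rw [A.apply_symm_apply, hA, hback]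
  have hgac : HasCompactSupport fun X => g (((Matrix.GeneralLinearGroup.mkOfDetNeZero !![(1 : ℂ), 1; 1, -1] det_cayleyTwo_ne_zero : GL (Fin 2) ℂ) : Matrix (Fin 2) (Fin 2) ℂ) * X * (((Matrix.GeneralLinearGroup.mkOfDetNeZero !![(1 : ℂ), 1; 1, -1] det_cayleyTwo_ne_zero)⁻¹ : GL (Fin 2) ℂ) : Matrix (Fin 2) (Fin 2) ℂ)) := by
    have h := hgc.comp_homeomorph A.toHomeomorph
    have e : g ∘ ⇑A.toHomeomorph = fun X => g (((Matrix.GeneralLinearGroup.mkOfDetNeZero !![(1 : ℂ), 1; 1, -1] det_cayleyTwo_ne_zero : GL (Fin 2) ℂ) : Matrix (Fin 2) (Fin 2) ℂ) * X * (((Matrix.GeneralLinearGroup.mkOfDetNeZero !![(1 : ℂ), 1; 1, -1] det_cayleyTwo_ne_zero)⁻¹ : GL (Fin 2) ℂ) : Matrix (Fin 2) (Fin 2) ℂ)) := funext fun X => by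
      rw [Function.comp_apply, ContinuousLinearEquiv.coe_toHomeomorph, hA]
    rwa [e] at h
  have he : ΩJ g = (ΩD (fun X => g (((Matrix.GeneralLinearGroup.mkOfDetNeZero !![(1 : ℂ), 1; 1, -1] det_cayleyTwo_ne_zero : GL (Fin 2) ℂ) : Matrix (Fin 2) (Fin 2) ℂ) * X * (((Matrix.GeneralLinearGroup.mkOfDetNeZero !![(1 : ℂ), 1; 1, -1] det_cayleyTwo_ne_zero)⁻¹ : GL (Fin 2) ℂ) : Matrix (Fin 2) (Fin 2) ℂ)))) ∘ ⇑A.symm.toHomeomorph := funext fun Y => by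
    rw [casimirJ_eq_casimirD_comp_cayley ΩD ΩJ hΩD hΩJ hg Y, Function.comp_apply, ContinuousLinearEquiv.coe_toHomeomorph, hAsymm]
  rw [he]
  exact (hasCompactSupport_casimir 1 1 ΩD hΩD hgac).comp_homeomorph _

/-- **The iterates `(1 + Ω_J)ᵏ f` stay in `C_c^∞`** (★ `RankOneCasimir.iterate_casimir_mem`'s twin for the split frame, via the bridge). [cite: Varadarajan1989, §6.4 Thm 24] -/
theorem iterate_casimirJ_mem (ΩJ : (Matrix (Fin 2) (Fin 2) ℂ → E) → Matrix (Fin 2) (Fin 2) ℂ → E)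
    (hΩJ : ∀ (g : Matrix (Fin 2) (Fin 2) ℂ → E) (Y : Matrix (Fin 2) (Fin 2) ℂ), ΩJ g Y =
      -(fderiv ℝ (fderiv ℝ g) Y (Y * !![0, I; I, 0]) (Y * !![0, I; I, 0]) + fderiv ℝ g Y (Y * !![0, I; I, 0] * !![0, I; I, 0])) +
        (fderiv ℝ (fderiv ℝ g) Y (Y * !![1, 0; 0, -1]) (Y * !![1, 0; 0, -1]) + fderiv ℝ g Y (Y * !![1, 0; 0, -1] * !![1, 0; 0, -1])) +
        (fderiv ℝ (fderiv ℝ g) Y (Y * !![0, I; -I, 0]) (Y * !![0, I; -I, 0]) + fderiv ℝ g Y (Y * !![0, I; -I, 0] * !![0, I; -I, 0])))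
    {f : Matrix (Fin 2) (Fin 2) ℂ → E} (hf : ContDiff ℝ ∞ f) (hfc : HasCompactSupport f) (k : ℕ) :
    ContDiff ℝ ∞ ((fun g => g + ΩJ g)^[k] f) ∧ HasCompactSupport ((fun g => g + ΩJ g)^[k] f) := by
  induction k with
  | zero => exact ⟨hf, hfc⟩
  | succ k ih =>
    rw [Function.iterate_succ_apply']
    exact ⟨ih.1.add (contDiff_casimirJ ΩJ hΩJ ih.1), ih.2.add (hasCompactSupport_casimirJ ΩJ hΩJ ih.1 ih.2)⟩

/-- **`(1 + Ω_D)ᵏ (f ∘ Ad_P) = ((1 + Ω_J)ᵏ f) ∘ Ad_P`** for `f ∈ C_c^∞(M₂(ℂ), E)` and every `k` (induction through the bridge; the iterates are smooth by `iterate_casimirJ_mem`) — the identity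
that carries ★ (ELL-∞)'s cone integrals of `(1+Ω_D)ᵏ(f ∘ Ad_P)` to the split frame. [cite: Varadarajan1989, §6.4 Thm 24] [cite: Rogawski1990, §8.2 p. 122] -/
theorem iterate_casimirD_comp_cayley_eq (ΩD ΩJ : (Matrix (Fin 2) (Fin 2) ℂ → E) → Matrix (Fin 2) (Fin 2) ℂ → E)
    (hΩD : ∀ (g : Matrix (Fin 2) (Fin 2) ℂ → E) (Y : Matrix (Fin 2) (Fin 2) ℂ), ΩD g Y =
      -(fderiv ℝ (fderiv ℝ g) Y (Y * !![I, 0; 0, -I]) (Y * !![I, 0; 0, -I]) + fderiv ℝ g Y (Y * !![I, 0; 0, -I] * !![I, 0; 0, -I])) +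
        (fderiv ℝ (fderiv ℝ g) Y (Y * !![(0 : ℂ), ((1 : ℝ) : ℂ); ((1 : ℝ) : ℂ), 0]) (Y * !![(0 : ℂ), ((1 : ℝ) : ℂ); ((1 : ℝ) : ℂ), 0]) +
          fderiv ℝ g Y (Y * !![(0 : ℂ), ((1 : ℝ) : ℂ); ((1 : ℝ) : ℂ), 0] * !![(0 : ℂ), ((1 : ℝ) : ℂ); ((1 : ℝ) : ℂ), 0])) +
        (fderiv ℝ (fderiv ℝ g) Y (Y * !![(0 : ℂ), -(((1 : ℝ) : ℂ) * I); ((1 : ℝ) : ℂ) * I, 0]) (Y * !![(0 : ℂ), -(((1 : ℝ) : ℂ) * I); ((1 : ℝ) : ℂ) * I, 0]) +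
          fderiv ℝ g Y (Y * !![(0 : ℂ), -(((1 : ℝ) : ℂ) * I); ((1 : ℝ) : ℂ) * I, 0] * !![(0 : ℂ), -(((1 : ℝ) : ℂ) * I); ((1 : ℝ) : ℂ) * I, 0])))
    (hΩJ : ∀ (g : Matrix (Fin 2) (Fin 2) ℂ → E) (Y : Matrix (Fin 2) (Fin 2) ℂ), ΩJ g Y =
      -(fderiv ℝ (fderiv ℝ g) Y (Y * !![0, I; I, 0]) (Y * !![0, I; I, 0]) + fderiv ℝ g Y (Y * !![0, I; I, 0] * !![0, I; I, 0])) +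
        (fderiv ℝ (fderiv ℝ g) Y (Y * !![1, 0; 0, -1]) (Y * !![1, 0; 0, -1]) + fderiv ℝ g Y (Y * !![1, 0; 0, -1] * !![1, 0; 0, -1])) +
        (fderiv ℝ (fderiv ℝ g) Y (Y * !![0, I; -I, 0]) (Y * !![0, I; -I, 0]) + fderiv ℝ g Y (Y * !![0, I; -I, 0] * !![0, I; -I, 0])))
    {f : Matrix (Fin 2) (Fin 2) ℂ → E} (hf : ContDiff ℝ ∞ f) (hfc : HasCompactSupport f) (k : ℕ) :
    (fun g => g + ΩD g)^[k] (fun X => f (((Matrix.GeneralLinearGroup.mkOfDetNeZero !![(1 : ℂ), 1; 1, -1] det_cayleyTwo_ne_zero : GL (Fin 2) ℂ) : Matrix (Fin 2) (Fin 2) ℂ) * X * (((Matrix.GeneralLinearGroup.mkOfDetNeZero !![(1 : ℂ), 1; 1, -1] det_cayleyTwo_ne_zero)⁻¹ : GL (Fin 2) ℂ) : Matrix (Fin 2) (Fin 2) ℂ))) = fun X => ((fun g => g + ΩJ g)^[k] f) (((Matrix.GeneralLinearGroup.mkOfDetNeZero !![(1 : ℂ), 1; 1, -1] det_cayleyTwo_ne_zero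 : GL (Fin 2) ℂ) : Matrix (Fin 2) (Fin 2) ℂ) * X * (((Matrix.GeneralLinearGroup.mkOfDetNeZero !![(1 : ℂ), 1; 1, -1] det_cayleyTwo_ne_zero)⁻¹ : GL (Fin 2) ℂ) : Matrix (Fin 2) (Fin 2) ℂ)) := by
  induction k with
  | zero => rfl
  | succ k ih =>
    rw [Function.iterate_succ_apply', ih, Function.iterate_succ_apply']
    funext X
    rw [Pi.add_apply, Pi.add_apply, casimirD_comp_cayley_eq ΩD ΩJ hΩD hΩJ (iterate_casimirJ_mem ΩJ hΩJ hf hfc k).1]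

end Bridge

/-! ## §2 The half chart: integrability, the radial equation `Λ_{Ωg} = Λ_g″ − Λ_g`, additivity -/

section HalfChart

variable {J : Matrix (Fin 2) (Fin 2) ℂ} (hJ : J = (StdForm.antidiagonal 2).over ℂ)
  [MeasurableSpace ↥(unitaryGroupOfForm (starRingEnd ℂ) J)] [BorelSpace ↥(unitaryGroupOfForm (starRingEnd ℂ) J)]
  {K : Subgroup ↥(unitaryGroupOfForm (starRingEnd ℂ) J)} (κ : Measure ↥K)
  (μN : Measure ↥(unipotentU (starRingEnd ℂ) J)) {E : Type*} [NormedAddCommGroup E] [NormedSpace ℝ E]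

omit [NormedSpace ℝ E] in
include hJ in
/-- **Integrability on the half chart**: for continuous compactly supported `g` and every `x, θ`, the integrand `(k, n) ↦ g(k·(t_{0,θ} h_{x∕2} n h_{x∕2})·k⁻¹)` of ★ p850603's chart
integral is continuous with support in ONE compact subset of `K × N` (★ FILE 2 `exists_isCompact_carrier_conj`), hence integrable for `κ ⊗ μ_N`. [cite: Folland1995, §2.6] -/
theorem integrable_prod_conj_hypBlockGL_half (hK : IsCompact (K : Set ↥(unitaryGroupOfForm (starRingEnd ℂ) J))) [IsHaarMeasure κ] [IsHaarMeasure μN]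
    {g : Matrix (Fin 2) (Fin 2) ℂ → E} (hg : Continuous g) (hgc : HasCompactSupport g) (x θ : ℝ) :
    Integrable (fun p : ↥K × ↥(unipotentU (starRingEnd ℂ) J) => g ((((((p.1 : ↥K) : ↥(unitaryGroupOfForm (starRingEnd ℂ) J)) * (((⟨hypBlockGL 0 θ, hypBlockGL_mem_of_eq_over hJ 0 θ⟩ : ↥(unitaryGroupOfForm (starRingEnd ℂ) J))) * ((⟨hypBlockGL (x / 2) 0, hypBlockGL_mem_of_eq_over hJ (x / 2) 0⟩ : ↥(unitaryGroupOfForm (starRingEnd ℂ) J))) * ((p.2 : ↥(unipotentU (starRingEnd ℂ) J)) : ↥(unitaryGroupOfForm (starRingEnd ℂ) J)) * ((⟨hypBlockGL (x / 2) 0, hypBlockGL_mem_of_eq_over hJ (x / 2) 0⟩ : ↥(unitaryGroupOfForm (starRingEnd ℂ) J)))) * ((p.1 : ↥K) : ↥(unitaryGroupOfForm (starRingEnd ℂ) J))⁻¹ : ↥(unitaryGroupOfForm (starRingEnd ℂ) J))) : GL (Fin 2) ℂ) : Matrix (Fin 2) (Fin 2) ℂ)) (κ.prod μN) := by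
  haveI : LocallyCompactSpace ↥(unitaryGroupOfForm (starRingEnd ℂ) J) := locallyCompactSpace_unitaryGroupOfForm_complex J
  haveI : SecondCountableTopology ↥(unitaryGroupOfForm (starRingEnd ℂ) J) := secondCountableTopology_unitaryGroupOfForm_complex J
  have hN : IsClosed (unipotentU (starRingEnd ℂ) J : Set ↥(unitaryGroupOfForm (starRingEnd ℂ) J)) := isClosed_unipotentU _ _
  haveI : LocallyCompactSpace ↥(unipotentU (starRingEnd ℂ) J) := hN.isClosedEmbedding_subtypeVal.locallyCompactSpace
  haveI : SecondCountableTopology ↥(unipotentU (starRingEnd ℂ) J) := TopologicalSpace.Subtype.secondCountableTopology _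
  haveI : SecondCountableTopology ↥K := TopologicalSpace.Subtype.secondCountableTopology _
  haveI : BorelSpace ↥(unipotentU (starRingEnd ℂ) J) := Subtype.borelSpace _
  haveI : BorelSpace ↥K := Subtype.borelSpace _
  haveI : BorelSpace (↥K × ↥(unipotentU (starRingEnd ℂ) J)) := Prod.borelSpace
  haveI : CompactSpace ↥K := isCompact_iff_compactSpace.1 hK
  haveI : LocallyCompactSpace ↥K := hK.isClosed.isClosedEmbedding_subtypeVal.locallyCompactSpace
  have hS₀ : IsCompact {u : ↥(unitaryGroupOfForm (starRingEnd ℂ) J) | ((u : GL (Fin 2) ℂ) : Matrix (Fin 2) (Fin 2) ℂ) ∈ tsupport g} :=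
    (isClosedEmbedding_coe_unitaryGroupOfForm_of_eq_over hJ).isCompact_preimage hgc
  obtain ⟨s, hs, hcar⟩ := exists_isCompact_carrier_conj (J := J) hK (fun _ : ℝ => ((⟨hypBlockGL 0 θ, hypBlockGL_mem_of_eq_over hJ 0 θ⟩ : ↥(unitaryGroupOfForm (starRingEnd ℂ) J))) * ((⟨hypBlockGL (x / 2) 0, hypBlockGL_mem_of_eq_over hJ (x / 2) 0⟩ : ↥(unitaryGroupOfForm (starRingEnd ℂ) J)))) (fun _ : ℝ => ((⟨hypBlockGL (x / 2) 0, hypBlockGL_mem_of_eq_over hJ (x / 2) 0⟩ : ↥(unitaryGroupOfForm (starRingEnd ℂ) J))))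
    continuous_const continuous_const hS₀ 0
  have h1 : Continuous fun p : ↥K × ↥(unipotentU (starRingEnd ℂ) J) => ((p.1 : ↥K) : ↥(unitaryGroupOfForm (starRingEnd ℂ) J)) := continuous_subtype_val.comp continuous_fst
  have h2 : Continuous fun p : ↥K × ↥(unipotentU (starRingEnd ℂ) J) => ((p.2 : ↥(unipotentU (starRingEnd ℂ) J)) : ↥(unitaryGroupOfForm (starRingEnd ℂ) J)) := continuous_subtype_val.comp continuous_snd
  have hc : Continuous fun p : ↥K × ↥(unipotentU (starRingEnd ℂ) J) => g ((((((p.1 : ↥K) : ↥(unitaryGroupOfForm (starRingEnd ℂ) J)) * (((⟨hypBlockGL 0 θ, hypBlockGL_mem_of_eq_over hJ 0 θ⟩ : ↥(unitaryGroupOfForm (starRingEnd ℂ) J))) * ((⟨hypBlockGL (x / 2) 0, hypBlockGL_mem_of_eq_over hJ (x / 2) 0⟩ : ↥(unitaryGroupOfForm (starRingEnd ℂ) J))) * ((p.2 : ↥(unipotentU (starRingEnd ℂ) J)) : ↥(unitaryGroupOfForm (starRingEnd ℂ) J)) * ((⟨hypBlockGL (x / 2) 0, hypBlockGL_mem_of_eq_over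 hJ (x / 2) 0⟩ : ↥(unitaryGroupOfForm (starRingEnd ℂ) J)))) * ((p.1 : ↥K) : ↥(unitaryGroupOfForm (starRingEnd ℂ) J))⁻¹ : ↥(unitaryGroupOfForm (starRingEnd ℂ) J))) : GL (Fin 2) ℂ) : Matrix (Fin 2) (Fin 2) ℂ) :=
    hg.comp ((Units.continuous_val.comp continuous_subtype_val).comp ((h1.mul ((continuous_const.mul h2).mul continuous_const)).mul h1.inv))
  refine hc.integrable_of_hasCompactSupport (HasCompactSupport.intro hs fun p hp => ?_)
  exact image_eq_zero_of_notMem_tsupport fun hmem => hp (hcar 0 (mem_closedBall_self zero_le_one) p hmem)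

include hJ in
/-- **HARISH-CHANDRA'S RADIAL EQUATION ON THE SPLIT TORUS, HALF CHART** (`F_{Ωf} = (∂² − ρ²)F_f`, `ρ = 1`).  With ★ p850603's chart integral
`Λ_g(x) = ∫_{K×N} g(k·(t_{0,θ} h_{x∕2} n h_{x∕2})·k⁻¹)` (`h_s = hypBlockGL s 0`; `|eˣ − e⁻ˣ| Φ^T = C • Λ` off the wall, ★ p850189) and the split-frame Casimir `Ω` (★ FILE 1, hypothesis `hΩ`):
`Λ_g ∈ C^∞(ℝ)` and **`Λ_{Ωg}(x) = Λ_g″(x) − Λ_g(x)` for EVERY `x`** — ★ FILE 2's full-chart equation `Ψ_{Ωg} = Ψ″ + 2Ψ′` and `Λ = eˣ • Ψ` (★ `integral_prod_conj_hypBlockGL_half_eq_exp_smul`).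
`Λ, Λ_Ω` are bound functions with their defining hypotheses. [cite: Varadarajan1989, §6.4 Thm 23] [cite: Knapp1986, Ch. VIII §5] [cite: Rogawski1990, §8.2 p. 119] -/
theorem casimir_integral_prod_conj_hypBlockGL_half_eq (hK : IsCompact (K : Set ↥(unitaryGroupOfForm (starRingEnd ℂ) J))) [IsHaarMeasure κ] [IsHaarMeasure μN]
    {g : Matrix (Fin 2) (Fin 2) ℂ → E} (hg : ContDiff ℝ ∞ g) (hgc : HasCompactSupport g)
    {Ω : (Matrix (Fin 2) (Fin 2) ℂ → E) → Matrix (Fin 2) (Fin 2) ℂ → E}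
    (hΩ : ∀ (g : Matrix (Fin 2) (Fin 2) ℂ → E) (Y : Matrix (Fin 2) (Fin 2) ℂ), Ω g Y =
      -(fderiv ℝ (fderiv ℝ g) Y (Y * !![0, I; I, 0]) (Y * !![0, I; I, 0]) + fderiv ℝ g Y (Y * !![0, I; I, 0] * !![0, I; I, 0])) +
        (fderiv ℝ (fderiv ℝ g) Y (Y * !![1, 0; 0, -1]) (Y * !![1, 0; 0, -1]) + fderiv ℝ g Y (Y * !![1, 0; 0, -1] * !![1, 0; 0, -1])) +
        (fderiv ℝ (fderiv ℝ g) Y (Y * !![0, I; -I, 0]) (Y * !![0, I; -I, 0]) + fderiv ℝ g Y (Y * !![0, I; -I, 0] * !![0, I; -I, 0])))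
    (θ : ℝ) {Λ ΛΩ : ℝ → E}
    (hΛ : ∀ x : ℝ, Λ x = ∫ p : ↥K × ↥(unipotentU (starRingEnd ℂ) J), g ((((((p.1 : ↥K) : ↥(unitaryGroupOfForm (starRingEnd ℂ) J)) * (((⟨hypBlockGL 0 θ, hypBlockGL_mem_of_eq_over hJ 0 θ⟩ : ↥(unitaryGroupOfForm (starRingEnd ℂ) J))) * ((⟨hypBlockGL (x / 2) 0, hypBlockGL_mem_of_eq_over hJ (x / 2) 0⟩ : ↥(unitaryGroupOfForm (starRingEnd ℂ) J))) * ((p.2 : ↥(unipotentU (starRingEnd ℂ) J)) : ↥(unitaryGroupOfForm (starRingEnd ℂ) J)) * ((⟨hypBlockGL (x / 2) 0, hypBlockGL_mem_of_eq_over hJ (x / 2) 0⟩ : ↥(unitaryGroupOfForm (starRingEnd ℂ) J)))) * ((p.1 : ↥K) : ↥(unitaryGroupOfForm (starRingEnd ℂ) J))⁻¹ : ↥(unitaryGroupOfForm (starRingEnd ℂ) J))) : GL (Fin 2) ℂ) : Matrix (Fin 2) (Fin 2) ℂ) ∂(κ.prod μN))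
    (hΛΩ : ∀ x : ℝ, ΛΩ x = ∫ p : ↥K × ↥(unipotentU (starRingEnd ℂ) J), Ω g ((((((p.1 : ↥K) : ↥(unitaryGroupOfForm (starRingEnd ℂ) J)) * (((⟨hypBlockGL 0 θ, hypBlockGL_mem_of_eq_over hJ 0 θ⟩ : ↥(unitaryGroupOfForm (starRingEnd ℂ) J))) * ((⟨hypBlockGL (x / 2) 0, hypBlockGL_mem_of_eq_over hJ (x / 2) 0⟩ : ↥(unitaryGroupOfForm (starRingEnd ℂ) J))) * ((p.2 : ↥(unipotentU (starRingEnd ℂ) J)) : ↥(unitaryGroupOfForm (starRingEnd ℂ) J)) * ((⟨hypBlockGL (x / 2) 0, hypBlockGL_mem_of_eq_over hJ (x / 2) 0⟩ : ↥(unitaryGroupOfForm (starRingEnd ℂ) J)))) * ((p.1 : ↥K) : ↥(unitaryGroupOfForm (starRingEnd ℂ) J))⁻¹ : ↥(unitaryGroupOfForm (starRingEnd ℂ) J))) : GL (Fin 2) ℂ) : Matrix (Fin 2) (Fin 2) ℂ) ∂(κ.prod μN)) :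
    ContDiff ℝ ∞ Λ ∧ ∀ x : ℝ, ΛΩ x = deriv (deriv Λ) x - Λ x := by
  haveI : CompactSpace ↥K := isCompact_iff_compactSpace.1 hK
  obtain ⟨hΨ, hΨΩ⟩ := casimir_integral_prod_conj_hypBlockGL_eq hJ κ μN hK hg hgc hΩ θ
    (Ψ := fun x => ∫ p : ↥K × ↥(unipotentU (starRingEnd ℂ) J), g ((((((p.1 : ↥K) : ↥(unitaryGroupOfForm (starRingEnd ℂ) J)) * (((⟨hypBlockGL x θ, hypBlockGL_mem_of_eq_over hJ x θ⟩ : ↥(unitaryGroupOfForm (starRingEnd ℂ) J))) * ((p.2 : ↥(unipotentU (starRingEnd ℂ) J)) : ↥(unitaryGroupOfForm (starRingEnd ℂ) J))) * ((p.1 : ↥K) : ↥(unitaryGroupOfForm (starRingEnd ℂ) J))⁻¹ : ↥(unitaryGroupOfForm (starRingEnd ℂ) J))) : GL (Fin 2) ℂ) : Matrix (Fin 2) (Fin 2) ℂ) ∂(κ.prod μN))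
    (ΨΩ := fun x => ∫ p : ↥K × ↥(unipotentU (starRingEnd ℂ) J), Ω g ((((((p.1 : ↥K) : ↥(unitaryGroupOfForm (starRingEnd ℂ) J)) * (((⟨hypBlockGL x θ, hypBlockGL_mem_of_eq_over hJ x θ⟩ : ↥(unitaryGroupOfForm (starRingEnd ℂ) J))) * ((p.2 : ↥(unipotentU (starRingEnd ℂ) J)) : ↥(unitaryGroupOfForm (starRingEnd ℂ) J))) * ((p.1 : ↥K) : ↥(unitaryGroupOfForm (starRingEnd ℂ) J))⁻¹ : ↥(unitaryGroupOfForm (starRingEnd ℂ) J))) : GL (Fin 2) ℂ) : Matrix (Fin 2) (Fin 2) ℂ) ∂(κ.prod μN)) (fun _ => rfl) (fun _ => rfl)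
  have hΛe : Λ = fun x => Real.exp x • ∫ p : ↥K × ↥(unipotentU (starRingEnd ℂ) J), g ((((((p.1 : ↥K) : ↥(unitaryGroupOfForm (starRingEnd ℂ) J)) * (((⟨hypBlockGL x θ, hypBlockGL_mem_of_eq_over hJ x θ⟩ : ↥(unitaryGroupOfForm (starRingEnd ℂ) J))) * ((p.2 : ↥(unipotentU (starRingEnd ℂ) J)) : ↥(unitaryGroupOfForm (starRingEnd ℂ) J))) * ((p.1 : ↥K) : ↥(unitaryGroupOfForm (starRingEnd ℂ) J))⁻¹ : ↥(unitaryGroupOfForm (starRingEnd ℂ) J))) : GL (Fin 2) ℂ) : Matrix (Fin 2) (Fin 2) ℂ) ∂(κ.prod μN) := by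
    funext x
    rw [hΛ]
    exact integral_prod_conj_hypBlockGL_half_eq_exp_smul hJ κ μN (fun u : ↥(unitaryGroupOfForm (starRingEnd ℂ) J) => g ((u : GL (Fin 2) ℂ) : Matrix (Fin 2) (Fin 2) ℂ)) x θ
  have hΛΩe : ∀ x, ΛΩ x = Real.exp x • ∫ p : ↥K × ↥(unipotentU (starRingEnd ℂ) J), Ω g ((((((p.1 : ↥K) : ↥(unitaryGroupOfForm (starRingEnd ℂ) J)) * (((⟨hypBlockGL x θ, hypBlockGL_mem_of_eq_over hJ x θ⟩ : ↥(unitaryGroupOfForm (starRingEnd ℂ) J))) * ((p.2 : ↥(unipotentU (starRingEnd ℂ) J)) : ↥(unitaryGroupOfForm (starRingEnd ℂ) J))) * ((p.1 : ↥K) : ↥(unitaryGroupOfForm (starRingEnd ℂ) J))⁻¹ : ↥(unitaryGroupOfForm (starRingEnd ℂ) J))) : GL (Fin 2) ℂ) : Matrix (Fin 2) (Fin 2) ℂ) ∂(κ.prod μN) := fun x => by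
    rw [hΛΩ]
    exact integral_prod_conj_hypBlockGL_half_eq_exp_smul hJ κ μN (fun u : ↥(unitaryGroupOfForm (starRingEnd ℂ) J) => Ω g ((u : GL (Fin 2) ℂ) : Matrix (Fin 2) (Fin 2) ℂ)) x θ
  -- abstract calculus: `Λ = exp • Ψ`, `Ψ_Ω = Ψ″ + 2Ψ′` ⇒ `Λ_Ω = Λ″ − Λ`
  set Ψ : ℝ → E := fun x => ∫ p : ↥K × ↥(unipotentU (starRingEnd ℂ) J), g ((((((p.1 : ↥K) : ↥(unitaryGroupOfForm (starRingEnd ℂ) J)) * (((⟨hypBlockGL x θ, hypBlockGL_mem_of_eq_over hJ x θ⟩ : ↥(unitaryGroupOfForm (starRingEnd ℂ) J))) * ((p.2 : ↥(unipotentU (starRingEnd ℂ) J)) : ↥(unitaryGroupOfForm (starRingEnd ℂ) J))) * ((p.1 : ↥K) : ↥(unitaryGroupOfForm (starRingEnd ℂ) J))⁻¹ : ↥(unitaryGroupOfForm (starRingEnd ℂ) J))) : GL (Fin 2) ℂ) : Matrix (Fin 2) (Fin 2) ℂ) ∂(κ.prod μN) with hΨdef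
  have hΨd : Differentiable ℝ Ψ := hΨ.differentiable (by simp)
  have hΨ'd : Differentiable ℝ (deriv Ψ) := (hΨ.iterate_deriv 1).differentiable (by simp)
  have hd1 : ∀ x, HasDerivAt Λ (Real.exp x • deriv Ψ x + Real.exp x • Ψ x) x := fun x => by
    rw [hΛe]
    exact (Real.hasDerivAt_exp x).smul (hΨd x).hasDerivAt
  have hd1' : deriv Λ = fun x => Real.exp x • deriv Ψ x + Real.exp x • Ψ x := funext fun x => (hd1 x).deriv
  have hd2 : ∀ x, HasDerivAt (deriv Λ) ((Real.exp x • deriv (deriv Ψ) x + Real.exp x • deriv Ψ x) + (Real.exp x • deriv Ψ x + Real.exp x • Ψ x)) x :=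
    fun x => by
    rw [hd1']
    exact ((Real.hasDerivAt_exp x).smul (hΨ'd x).hasDerivAt).add ((Real.hasDerivAt_exp x).smul (hΨd x).hasDerivAt)
  refine ⟨by rw [hΛe]; exact Real.contDiff_exp.smul hΨ, fun x => ?_⟩
  rw [(hd2 x).deriv, hΛΩe x, hΨΩ x, hΛe]
  simp only [smul_add, two_smul]
  abel

include hJ in
/-- **Additivity of the half-chart integral** in the test function (both integrands integrable by `integrable_prod_conj_hypBlockGL_half`). [cite: Folland1995, §2.6] -/
theorem integral_prod_conj_hypBlockGL_half_add (hK : IsCompact (K : Set ↥(unitaryGroupOfForm (starRingEnd ℂ) J))) [IsHaarMeasure κ] [IsHaarMeasure μN]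
    {f g : Matrix (Fin 2) (Fin 2) ℂ → E} (hf : Continuous f) (hfc : HasCompactSupport f) (hg : Continuous g) (hgc : HasCompactSupport g) (x θ : ℝ) :
    ∫ p : ↥K × ↥(unipotentU (starRingEnd ℂ) J), (f + g) ((((((p.1 : ↥K) : ↥(unitaryGroupOfForm (starRingEnd ℂ) J)) * (((⟨hypBlockGL 0 θ, hypBlockGL_mem_of_eq_over hJ 0 θ⟩ : ↥(unitaryGroupOfForm (starRingEnd ℂ) J))) * ((⟨hypBlockGL (x / 2) 0, hypBlockGL_mem_of_eq_over hJ (x / 2) 0⟩ : ↥(unitaryGroupOfForm (starRingEnd ℂ) J))) * ((p.2 : ↥(unipotentU (starRingEnd ℂ) J)) : ↥(unitaryGroupOfForm (starRingEnd ℂ) J)) * ((⟨hypBlockGL (x / 2) 0, hypBlockGL_mem_of_eq_over hJ (x / 2) 0⟩ : ↥(unitaryGroupOfForm (starRingEnd ℂ) J)))) * ((p.1 : ↥K) : ↥(unitaryGroupOfForm (starRingEnd ℂ) J))⁻¹ : ↥(unitaryGroupOfForm (starRingEnd ℂ) J))) : GL (Fin 2) ℂ) : Matrix (Fin 2) (Fin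 2) ℂ) ∂(κ.prod μN) =
      (∫ p : ↥K × ↥(unipotentU (starRingEnd ℂ) J), f ((((((p.1 : ↥K) : ↥(unitaryGroupOfForm (starRingEnd ℂ) J)) * (((⟨hypBlockGL 0 θ, hypBlockGL_mem_of_eq_over hJ 0 θ⟩ : ↥(unitaryGroupOfForm (starRingEnd ℂ) J))) * ((⟨hypBlockGL (x / 2) 0, hypBlockGL_mem_of_eq_over hJ (x / 2) 0⟩ : ↥(unitaryGroupOfForm (starRingEnd ℂ) J))) * ((p.2 : ↥(unipotentU (starRingEnd ℂ) J)) : ↥(unitaryGroupOfForm (starRingEnd ℂ) J)) * ((⟨hypBlockGL (x / 2) 0, hypBlockGL_mem_of_eq_over hJ (x / 2) 0⟩ : ↥(unitaryGroupOfForm (starRingEnd ℂ) J)))) * ((p.1 : ↥K) : ↥(unitaryGroupOfForm (starRingEnd ℂ) J))⁻¹ : ↥(unitaryGroupOfForm (starRingEnd ℂ) J))) : GL (Fin 2) ℂ) : Matrix (Fin 2) (Fin 2) ℂ) ∂(κ.prod μN)) +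
      ∫ p : ↥K × ↥(unipotentU (starRingEnd ℂ) J), g ((((((p.1 : ↥K) : ↥(unitaryGroupOfForm (starRingEnd ℂ) J)) * (((⟨hypBlockGL 0 θ, hypBlockGL_mem_of_eq_over hJ 0 θ⟩ : ↥(unitaryGroupOfForm (starRingEnd ℂ) J))) * ((⟨hypBlockGL (x / 2) 0, hypBlockGL_mem_of_eq_over hJ (x / 2) 0⟩ : ↥(unitaryGroupOfForm (starRingEnd ℂ) J))) * ((p.2 : ↥(unipotentU (starRingEnd ℂ) J)) : ↥(unitaryGroupOfForm (starRingEnd ℂ) J)) * ((⟨hypBlockGL (x / 2) 0, hypBlockGL_mem_of_eq_over hJ (x / 2) 0⟩ : ↥(unitaryGroupOfForm (starRingEnd ℂ) J)))) * ((p.1 : ↥K) : ↥(unitaryGroupOfForm (starRingEnd ℂ) J))⁻¹ : ↥(unitaryGroupOfForm (starRingEnd ℂ) J))) : GL (Fin 2) ℂ) : Matrix (Fin 2) (Fin 2) ℂ) ∂(κ.prod μN) := by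
  simp only [Pi.add_apply]
  exact integral_add (integrable_prod_conj_hypBlockGL_half hJ κ μN hK hf hfc x θ) (integrable_prod_conj_hypBlockGL_half hJ κ μN hK hg hgc x θ)

end HalfChart

/-! ## §3 THE SPLIT LADDER: all `x`-jets of `Λ_f` in closed form, at every `x` (no singular set on the split Cartan) -/

section Ladder

variable {J : Matrix (Fin 2) (Fin 2) ℂ} (hJ : J = (StdForm.antidiagonal 2).over ℂ)
  [MeasurableSpace ↥(unitaryGroupOfForm (starRingEnd ℂ) J)] [BorelSpace ↥(unitaryGroupOfForm (starRingEnd ℂ) J)]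
  {K : Subgroup ↥(unitaryGroupOfForm (starRingEnd ℂ) J)} (κ : Measure ↥K)
  (μN : Measure ↥(unipotentU (starRingEnd ℂ) J)) {E : Type*} [NormedAddCommGroup E] [NormedSpace ℝ E]

include hJ in
/-- **THE SPLIT LADDER (Harish-Chandra's `F_{(1+Ω)f} = F_f″` on the split Cartan, iterated).**  `Λ : (M₂(ℂ) → E) → ℝ → E` the half-chart family (bound, hypothesis `hΛ`; ★ p850603
token shape), `Ω` the split-frame Casimir (`hΩ`), `f ∈ C_c^∞(M₂(ℂ), E)`.  Then for every `k` and EVERY `x ∈ ℝ`: `Λ_f ∈ C^∞`,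
**`Λ_f⁽²ᵏ⁾(x) = Λ_{(1+Ω)ᵏ f}(x)`** and **`Λ_f⁽²ᵏ⁺¹⁾(x) = (Λ_{(1+Ω)ᵏ f})′(x)`** — induction on `k` over §2 (`Λ_g″ = Λ_g + Λ_{Ωg} = Λ_{g + Ωg}`, additivity, `(1+Ω)ᵏ f ∈ C_c^∞` by §1).
The split recursion has the sign OPPOSITE to the elliptic ladder ★ `RankOneCasimir.hasDerivAt_iteratedDeriv_and_ladder` (`F⁽ⁿ⁺²⁾ = −(F⁽ⁿ⁾ + F_Ω⁽ⁿ⁾)` there: `x = iψ`), and needs no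
one-sided machinery. [cite: Varadarajan1989, §6.4 Thms 23–24] [cite: Knapp1986, Ch. VIII §5] [cite: Shelstad1979, Lemma 4.3 p. 25] -/
theorem iteratedDeriv_integral_prod_conj_hypBlockGL_half (hK : IsCompact (K : Set ↥(unitaryGroupOfForm (starRingEnd ℂ) J))) [IsHaarMeasure κ] [IsHaarMeasure μN]
    (Ω : (Matrix (Fin 2) (Fin 2) ℂ → E) → Matrix (Fin 2) (Fin 2) ℂ → E)
    (hΩ : ∀ (g : Matrix (Fin 2) (Fin 2) ℂ → E) (Y : Matrix (Fin 2) (Fin 2) ℂ), Ω g Y =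
      -(fderiv ℝ (fderiv ℝ g) Y (Y * !![0, I; I, 0]) (Y * !![0, I; I, 0]) + fderiv ℝ g Y (Y * !![0, I; I, 0] * !![0, I; I, 0])) +
        (fderiv ℝ (fderiv ℝ g) Y (Y * !![1, 0; 0, -1]) (Y * !![1, 0; 0, -1]) + fderiv ℝ g Y (Y * !![1, 0; 0, -1] * !![1, 0; 0, -1])) +
        (fderiv ℝ (fderiv ℝ g) Y (Y * !![0, I; -I, 0]) (Y * !![0, I; -I, 0]) + fderiv ℝ g Y (Y * !![0, I; -I, 0] * !![0, I; -I, 0])))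
    (θ : ℝ) (Λ : (Matrix (Fin 2) (Fin 2) ℂ → E) → ℝ → E)
    (hΛ : ∀ (g : Matrix (Fin 2) (Fin 2) ℂ → E) (x : ℝ), Λ g x = ∫ p : ↥K × ↥(unipotentU (starRingEnd ℂ) J), g ((((((p.1 : ↥K) : ↥(unitaryGroupOfForm (starRingEnd ℂ) J)) * (((⟨hypBlockGL 0 θ, hypBlockGL_mem_of_eq_over hJ 0 θ⟩ : ↥(unitaryGroupOfForm (starRingEnd ℂ) J))) * ((⟨hypBlockGL (x / 2) 0, hypBlockGL_mem_of_eq_over hJ (x / 2) 0⟩ : ↥(unitaryGroupOfForm (starRingEnd ℂ) J))) * ((p.2 : ↥(unipotentU (starRingEnd ℂ) J)) : ↥(unitaryGroupOfForm (starRingEnd ℂ) J)) * ((⟨hypBlockGL (x / 2) 0, hypBlockGL_mem_of_eq_over hJ (x / 2) 0⟩ : ↥(unitaryGroupOfForm (starRingEnd ℂ) J)))) * ((p.1 : ↥K) : ↥(unitaryGroupOfForm (starRingEnd ℂ) J))⁻¹ : ↥(unitaryGroupOfForm (starRingEnd ℂ) J))) : GL (Fin 2) ℂ) : Matrix (Fin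 2) (Fin 2) ℂ) ∂(κ.prod μN))
    {f : Matrix (Fin 2) (Fin 2) ℂ → E} (hf : ContDiff ℝ ∞ f) (hfc : HasCompactSupport f) (k : ℕ) :
    ContDiff ℝ ∞ (Λ f) ∧ (∀ x : ℝ, iteratedDeriv (2 * k) (Λ f) x = Λ ((fun g => g + Ω g)^[k] f) x) ∧
      ∀ x : ℝ, iteratedDeriv (2 * k + 1) (Λ f) x = deriv (Λ ((fun g => g + Ω g)^[k] f)) x := by
  -- §2 for every smooth compactly supported `g`: smoothness and `Λ_g″ = Λ_{g + Ωg}`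
  have key : ∀ g : Matrix (Fin 2) (Fin 2) ℂ → E, ContDiff ℝ ∞ g → HasCompactSupport g →
      ContDiff ℝ ∞ (Λ g) ∧ deriv (deriv (Λ g)) = Λ (g + Ω g) := by
    intro g hg hgc
    obtain ⟨hs, heq⟩ := casimir_integral_prod_conj_hypBlockGL_half_eq hJ κ μN hK hg hgc hΩ θ (Λ := Λ g) (ΛΩ := Λ (Ω g)) (hΛ g) (hΛ (Ω g))
    refine ⟨hs, funext fun x => ?_⟩
    rw [hΛ (g + Ω g), integral_prod_conj_hypBlockGL_half_add hJ κ μN hK hg.continuous hgc (contDiff_casimirJ Ω hΩ hg).continuous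
      (hasCompactSupport_casimirJ Ω hΩ hg hgc) x θ, ← hΛ g, ← hΛ (Ω g), heq x]
    abel
  have heven : ∀ (k : ℕ) (g : Matrix (Fin 2) (Fin 2) ℂ → E), ContDiff ℝ ∞ g → HasCompactSupport g →
      iteratedDeriv (2 * k) (Λ g) = Λ ((fun g => g + Ω g)^[k] g) := by
    intro k
    induction k with
    | zero => intro g _ _; rw [Nat.mul_zero, iteratedDeriv_zero]; rfl
    | succ k ih =>
      intro g hg hgc
      rw [show 2 * (k + 1) = 2 * k + 1 + 1 by ring, iteratedDeriv_succ', iteratedDeriv_succ', (key g hg hgc).2,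
        ih (g + Ω g) (hg.add (contDiff_casimirJ Ω hΩ hg)) (hgc.add (hasCompactSupport_casimirJ Ω hΩ hg hgc)), Function.iterate_succ_apply]
  refine ⟨(key f hf hfc).1, fun x => by rw [heven k f hf hfc], fun x => ?_⟩
  rw [iteratedDeriv_succ, heven k f hf hfc]

include hJ in
/-- **THE `x`-JETS AT THE CENTRE.**  For `f ∈ C_c^∞` and every `k`: **`Λ_f⁽²ᵏ⁾(0) = ∫_{K×N} ((1+Ω)ᵏ f)(e^{iθ} · k n k⁻¹) d(κ ⊗ μ_N)`** — the `K`-saturated two-nappe CONE integral of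
`(1+Ω)ᵏ f` at the central element (★ p850189 `integral_prod_conj_hypBlockGL_half_zero`), the split-side entry of the all-orders rank-one jump relation; and
`Λ_f⁽²ᵏ⁺¹⁾(0) = (Λ_{(1+Ω)ᵏ f})′(0)`. [cite: Varadarajan1989, §6.4 Thms 23–24] [cite: Shelstad1979, Lemma 4.3 p. 25, Prop. 4.5 p. 26] [cite: Rogawski1990, §8.2 pp. 119–122] -/
theorem iteratedDeriv_integral_prod_conj_hypBlockGL_half_zero (hK : IsCompact (K : Set ↥(unitaryGroupOfForm (starRingEnd ℂ) J))) [IsHaarMeasure κ] [IsHaarMeasure μN]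
    (Ω : (Matrix (Fin 2) (Fin 2) ℂ → E) → Matrix (Fin 2) (Fin 2) ℂ → E)
    (hΩ : ∀ (g : Matrix (Fin 2) (Fin 2) ℂ → E) (Y : Matrix (Fin 2) (Fin 2) ℂ), Ω g Y =
      -(fderiv ℝ (fderiv ℝ g) Y (Y * !![0, I; I, 0]) (Y * !![0, I; I, 0]) + fderiv ℝ g Y (Y * !![0, I; I, 0] * !![0, I; I, 0])) +
        (fderiv ℝ (fderiv ℝ g) Y (Y * !![1, 0; 0, -1]) (Y * !![1, 0; 0, -1]) + fderiv ℝ g Y (Y * !![1, 0; 0, -1] * !![1, 0; 0, -1])) +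
        (fderiv ℝ (fderiv ℝ g) Y (Y * !![0, I; -I, 0]) (Y * !![0, I; -I, 0]) + fderiv ℝ g Y (Y * !![0, I; -I, 0] * !![0, I; -I, 0])))
    (θ : ℝ) (Λ : (Matrix (Fin 2) (Fin 2) ℂ → E) → ℝ → E)
    (hΛ : ∀ (g : Matrix (Fin 2) (Fin 2) ℂ → E) (x : ℝ), Λ g x = ∫ p : ↥K × ↥(unipotentU (starRingEnd ℂ) J), g ((((((p.1 : ↥K) : ↥(unitaryGroupOfForm (starRingEnd ℂ) J)) * (((⟨hypBlockGL 0 θ, hypBlockGL_mem_of_eq_over hJ 0 θ⟩ : ↥(unitaryGroupOfForm (starRingEnd ℂ) J))) * ((⟨hypBlockGL (x / 2) 0, hypBlockGL_mem_of_eq_over hJ (x / 2) 0⟩ : ↥(unitaryGroupOfForm (starRingEnd ℂ) J))) * ((p.2 : ↥(unipotentU (starRingEnd ℂ) J)) : ↥(unitaryGroupOfForm (starRingEnd ℂ) J)) * ((⟨hypBlockGL (x / 2) 0, hypBlockGL_mem_of_eq_over hJ (x / 2) 0⟩ : ↥(unitaryGroupOfForm (starRingEnd ℂ) J)))) * ((p.1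 : ↥K) : ↥(unitaryGroupOfForm (starRingEnd ℂ) J))⁻¹ : ↥(unitaryGroupOfForm (starRingEnd ℂ) J))) : GL (Fin 2) ℂ) : Matrix (Fin 2) (Fin 2) ℂ) ∂(κ.prod μN))
    {f : Matrix (Fin 2) (Fin 2) ℂ → E} (hf : ContDiff ℝ ∞ f) (hfc : HasCompactSupport f) (k : ℕ) :
    iteratedDeriv (2 * k) (Λ f) 0 = ∫ p : ↥K × ↥(unipotentU (starRingEnd ℂ) J), ((fun g => g + Ω g)^[k] f) ((((((⟨hypBlockGL 0 θ, hypBlockGL_mem_of_eq_over hJ 0 θ⟩ : ↥(unitaryGroupOfForm (starRingEnd ℂ) J))) * (((p.1 : ↥K) : ↥(unitaryGroupOfForm (starRingEnd ℂ) J)) * ((p.2 : ↥(unipotentU (starRingEnd ℂ) J)) : ↥(unitaryGroupOfForm (starRingEnd ℂ) J)) * ((p.1 : ↥K) : ↥(unitaryGroupOfForm (starRingEnd ℂ) J))⁻¹) : ↥(unitaryGroupOfForm (starRingEnd ℂ) J))) : GL (Fin 2) ℂ) : Matrix (Fin 2) (Fin 2) ℂ) ∂(κ.prod μN) ∧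
      iteratedDeriv (2 * k + 1) (Λ f) 0 = deriv (Λ ((fun g => g + Ω g)^[k] f)) 0 := by
  obtain ⟨-, he, ho⟩ := iteratedDeriv_integral_prod_conj_hypBlockGL_half hJ κ μN hK Ω hΩ θ Λ hΛ hf hfc k
  refine ⟨?_, ho 0⟩
  rw [he 0, hΛ]
  exact integral_prod_conj_hypBlockGL_half_zero hJ κ μN (fun u : ↥(unitaryGroupOfForm (starRingEnd ℂ) J) => ((fun g => g + Ω g)^[k] f) ((u : GL (Fin 2) ℂ) : Matrix (Fin 2) (Fin 2) ℂ)) θ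

end Ladder

end UnitaryGroup

end Literature.NumberTheory.Automorphic

end
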